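import Summits.BirchSwinnertonDyer.BirchSwinnertonDyer.Theorems.GenusKolyvaginAtTwoMinimalTwinBSDTwoComponentRoadFrame
import Literature.NumberTheory.EllipticCurves.CanonicalPAdicHeightRestrictionProofs
import Mathlib.RingTheory.Ideal.GoingUp
import HarnessLib

/-!
# Route `GenusKolyvaginAtTwo`, crux U₂ `MinimalTwinBSDTwo` (stmt-BirchSwinnertonDyer-22985), LINE 23 «twin_swap» v2.5, stub DIV′:
# THE COMPONENT ROAD READ AT THE RATIONAL PRIME — `2^s ∣ y_K` from the component class of a generator of `W(ℚ)` in `Φ_{q₀}(ℚ)`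

Width seat `bsd-line-gk2-p4` g36 (cell `bsd-f1-sign2`), `--supports stmt-BirchSwinnertonDyer-22985` (helper; closes nothing).
THEOREMS ONLY (no definition, no named fact, no `sorry`); standard axioms.  **BSD is NOT proved by this file; U₂ / DIV′ are NOT proved;
no item is closed.**  §1–§3 are UNCONDITIONAL; §4 is CONDITIONAL (D-0014) on the statement-only PUBLISHED fact
`Gross1991_heegnerPoint_sub_ratTorsion_mem_E0_imageFree` (Gross 1991 §6 / Gross–Zagier 1986 III (3.1)), displayed, exactly as its parent
`…MinimalTwinBSDTwoComponentRoadFrame` (gk2-p2 g29).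

THE POINT.  The component road (gk2-p2 g29, `…ComponentRoad` §4 + `…ComponentRoadFrame`) proves `2^s ∣ P(1)` in `W(K[1])` from the hypothesis
«`k • g₁ ∈ E₀(K[1])_{w₀} ⟹ 2^s ∣ k`» on the image `g₁ ∈ W(K[1])` of a generator `g` of `W(ℚ)/tors`, at ONE place `w₀ ∣ N` of the ring class field
`K[1]` — and leaves «reading it on `Φ_{q₀}(ℚ_{q₀})` (unramified descent `K[1]_{w₀} ⊇ ℚ_{q₀}`)» to the consumer.  This file does that reading,
and shows that NO ramification hypothesis is needed: `E₀` for the FIXED (globally minimal, integral) equation `W` is defined by `|x|_w > 1` or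
`Φ_x`, `Φ_y` a `w`-adic unit, and on RATIONAL numbers `ord_w = e(w|q₀) · ord_{q₀}` has the same sign — so for a rational point `P ∈ W(ℚ)` and ANY
finite place `w` of ANY number field `L` above the rational prime `ℓ`, **`P ∈ E₀(L)_w ⟺ P ∈ E₀(ℚ)_ℓ`**, the right-hand side in the tree's
`padicValRat` currency `WeierstrassCurve.HasNonsingularReductionAt ℓ x y` (`CanonicalPAdicHeight.lean`; the currency of the per-curve certificate
files `…hasNonsingularReductionAt_Q`).

* §1 `one_lt_valuation_ratCast_iff_padicValRat_neg`, `valuation_ratCast_eq_one_iff_padicValRat_eq_zero` — for `q ∈ ℚ` and a place `w ∋ ℓ`: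
  `|q|_w > 1 ⟺ ord_ℓ q < 0`, `|q|_w = 1 ⟺ q ≠ 0 ∧ ord_ℓ q = 0` (the tree had the two forward implications, `CanonicalPAdicHeightRestrictionProofs`;
  the missing third `0 < ord_ℓ q ⟹ |q|_w < 1` closes the trichotomy).
* §2 ★ `hasNonsingularReductionAtK_algebraMap_iff`, `hasNonsingularReduction_placeIntModel_pointToBaseChange_some_iff`, `…_iff_forall` — **`E₀` OF A
  RATIONAL POINT IS READ AT THE RATIONAL PRIME**: `(x, y) ∈ E₀(L)_w ⟺ W.HasNonsingularReductionAt ℓ x y`, any `L`, any `w ∋ ℓ`.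
* §3 `zsmul_pointToBaseChange`, ★ `natCast_dvd_of_componentOrder` — multiples commute with `E(ℚ) → E(L)`; and the CERTIFICATE FORM of the
  component-order hypothesis: if `m • g ∈ E₀(ℚ)_ℓ` and `k • g ∉ E₀(ℚ)_ℓ` for `0 < k < m` (finitely many rational points to test), then
  `k • g ∈ E₀(ℚ)_ℓ ⟹ m ∣ k` for every `k ∈ ℤ` (`E₀(L)_w ∩ W(ℚ)` is a subgroup; Euclid).
* §4 ★★ `exists_two_pow_smul_eq_derivedPoint_one_of_generator_componentOrder_rat` (+ `…_of_analyticRank_eq_one`, + the certificate form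
  `…_of_componentOrder_certificate`) — gk2-p2's component road with its hypothesis AT THE RATIONAL PRIME `q₀ ∣ N`: `W/ℚ` globally minimal,
  `W(ℚ)[2] = 0`, `w(W) = −1` (resp. `r_an(W) = 1`), `K` Heegner with odd `d_K ≠ −3`, a conductor-`1` datum `d₁`, `g` a generator of `W(ℚ)/tors`:
  **«`k • g ∈ E₀(ℚ)_{q₀} ⟹ 2^s ∣ k`» ⟹ `2^s ∣ P(1)` in `W(K[1])`**, granted GZ III (3.1).  With `2^s` the `2`-part of the order of the component
  of `g` in `Φ_{q₀}(ℚ_{q₀}) = W(ℚ_{q₀})/W₀(ℚ_{q₀})` this is the -data-readable instrument (one rational point, one bad prime, `padicValRat` of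
  three rational numbers per multiple); on the sub-slice where that component generates the `2`-part of the Tamagawa product it is the
  divisibility «`2^{ord₂ C(W)} ∣ P(1)`» of DIV′ from PRINT instead of crux 27467 (gk2-p2 g28/g29's reading; MAX-type, one prime at a time).

READING (census, not progress on BSD).  Nothing here proves DIV′, NDIV′, U₂, a WALL row or BSD for any curve; the file only removes the last
piece of plumbing between the component road and a rational-point computation.

References: [SilvermanAEC2009] VII §1 Prop. 1.3, VII §2 Prop. 2.1 (E₀ is a subgroup; reduction of a fixed equation); [NeukirchANT1999] Ch. I §8, Ch. II §8
(`ord_w|_ℚ = e(w|ℓ) · ord_ℓ`); [GrossLMS1991] §6 proof of Prop. 6.2 (1), §4 (4.1); [GrossZagier1986Heegner] III (3.1); [MazurSteinTate2006] §1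
(non-singular reduction of rational points in `padicValRat` form).

presearch (D-0021): `lean search` for `hasNonsingularReduction.*pointToBaseChange`, `HasNonsingularReductionAtK.*algebraMap`,
`valuation_ratCast.*iff` → only the forward lemmas `one_lt_valuation_ratCast_of_padicValRat_neg` / `valuation_ratCast_eq_one_of_padicValRat_eq_zero`
(used here) and the general transport `hasNonsingularReduction_some_iff_of_ringHom` (`NonsingularReductionEmbedding` §2; not needed once §1 is in
`padicValRat` form); literature: tree-internal plumbing, no print source beyond AEC VII.
-/

set_option autoImplicit false
set_option linter.dupNamespace false -- `Summit.<P>.<Sub>` repeats `BirchSwinnertonDyer` (D-0017)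

noncomputable section

open scoped Classical

open NumberField WeierstrassCurve IsDedekindDomain
open Literature.NumberTheory.EllipticCurves Literature.NumberTheory.EllipticCurves.ModularForms
open Summit.BirchSwinnertonDyer.BirchSwinnertonDyer.Theorems.GenusExact.TwinSwapBit (rootNumber_eq_neg_one_of_analyticRank_eq_one)

namespace Summit.BirchSwinnertonDyer.BirchSwinnertonDyer.Theorems.GenusExact.TwinSwap.ComponentRoad.Rational

/-! ## §1 Rational numbers at a finite place above `ℓ`: `|q|_w` versus `ord_ℓ q` (iff forms) -/

section Places

variable {L : Type*} [Field L] [NumberField L] {w : HeightOneSpectrum (𝓞 L)} {ℓ : ℕ}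

/-- Every rational prime `ℓ` lies under some finite place of a number field (going up along `ℤ → 𝓞_L`). [folklore]
[cite: NeukirchANT1999, Ch. I §8 (8.1)–(8.3) (primes of 𝓞_L above a rational prime)] -/
theorem exists_heightOneSpectrum_natCast_mem (L : Type*) [Field L] [NumberField L] {p : ℕ} (hp : p.Prime) :
    ∃ w : HeightOneSpectrum (𝓞 L), (p : 𝓞 L) ∈ w.asIdeal := by
  haveI hmax : (Ideal.span {(p : ℤ)}).IsMaximal :=
    PrincipalIdealRing.isMaximal_of_irreducible (Nat.prime_iff_prime_int.mp hp).irreducible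
  obtain ⟨Q, hQmax, hQ⟩ := Ideal.exists_ideal_over_maximal_of_isIntegral (S := 𝓞 L)
    (Ideal.span {(p : ℤ)}) (by
      rw [(RingHom.injective_iff_ker_eq_bot _).mp (algebraMap ℤ (𝓞 L)).injective_int]
      exact bot_le)
  have hpQ : (p : 𝓞 L) ∈ Q := by
    have : (p : ℤ) ∈ Q.comap (algebraMap ℤ (𝓞 L)) := by
      rw [hQ]; exact Ideal.mem_span_singleton_self _
    simpa [Ideal.mem_comap] using this
  have hQne : Q ≠ ⊥ := by
    intro hbot
    rw [hbot, Ideal.mem_bot] at hpQ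
    exact hp.ne_zero (by exact_mod_cast hpQ)
  exact ⟨⟨Q, hQmax.isPrime, hQne⟩, hpQ⟩

/-- `0 < ord_ℓ q` forces `ℓ ∣ num q` and `ℓ ∤ den q`. [folklore] -/
theorem dvd_num_of_padicValRat_pos (hℓ : ℓ.Prime) {q : ℚ} (hq : 0 < padicValRat ℓ q) :
    (ℓ : ℤ) ∣ q.num ∧ ¬ ℓ ∣ q.den := by
  haveI := Fact.mk hℓ
  have hnum : (ℓ : ℤ) ∣ q.num := by
    by_contra h
    have h0 : padicValInt ℓ q.num = 0 := by
      rw [padicValInt, padicValNat.eq_zero_of_not_dvd]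
      exact fun h' => h (Int.natCast_dvd.mpr h')
    have : padicValRat ℓ q ≤ 0 := by
      simp only [padicValRat, h0, CharP.cast_eq_zero, zero_sub, Left.neg_nonpos_iff]
      exact Int.natCast_nonneg _
    exact absurd hq (not_lt.mpr this)
  exact ⟨hnum, fun hd => not_dvd_num_of_dvd_den hℓ hd hnum⟩

/-- **A rational with `0 < ord_ℓ q` has `|q|_w < 1` at every place `w` above `ℓ`** (the third leg of the trichotomy; the tree has
`ord_ℓ q < 0 ⟹ |q|_w > 1` and `ord_ℓ q = 0 ⟹ |q|_w = 1`). [folklore] [cite: NeukirchANT1999, Ch. II §8 (w ∣ v, e(w|v): ord_w = e·ord_v on the ground field)] -/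
theorem valuation_ratCast_lt_one_of_padicValRat_pos (hℓ : ℓ.Prime) (hℓw : (ℓ : 𝓞 L) ∈ w.asIdeal) {q : ℚ}
    (hq : 0 < padicValRat ℓ q) : w.valuation L (q : L) < 1 := by
  obtain ⟨hnum, hden⟩ := dvd_num_of_padicValRat_pos hℓ hq
  have hden' : ¬ (ℓ : ℤ) ∣ (q.den : ℤ) := fun h => hden (Int.natCast_dvd_natCast.mp h)
  rw [Rat.cast_def, map_div₀, ← Int.cast_natCast q.den, valuation_intCast_eq_one_of_not_dvd hℓ hℓw hden', div_one]
  obtain ⟨k, hk⟩ := hnum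
  have e : ((q.num : ℤ) : L) = algebraMap (𝓞 L) L ((ℓ : 𝓞 L) * (k : 𝓞 L)) := by rw [hk]; simp
  rw [e]
  exact (HeightOneSpectrum.valuation_lt_one_iff_mem w _).mpr (w.asIdeal.mul_mem_right _ hℓw)

/-- **`|q|_w > 1 ⟺ ord_ℓ q < 0`** for `q ∈ ℚ` and a finite place `w` above `ℓ`. [folklore] [cite: NeukirchANT1999, Ch. II §8 (w ∣ v, e(w|v): ord_w = e·ord_v on the ground field)] -/
theorem one_lt_valuation_ratCast_iff_padicValRat_neg (hℓ : ℓ.Prime) (hℓw : (ℓ : 𝓞 L) ∈ w.asIdeal) (q : ℚ) :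
    1 < w.valuation L (q : L) ↔ padicValRat ℓ q < 0 := by
  refine ⟨fun h => ?_, one_lt_valuation_ratCast_of_padicValRat_neg hℓ hℓw⟩
  rcases lt_trichotomy (padicValRat ℓ q) 0 with hneg | h0 | hpos
  · exact hneg
  · exfalso
    by_cases hq0 : q = 0
    · subst hq0; simp at h
    · rw [valuation_ratCast_eq_one_of_padicValRat_eq_zero hℓ hℓw hq0 h0] at h
      exact lt_irrefl _ h
  · exact absurd h (not_lt.mpr (valuation_ratCast_lt_one_of_padicValRat_pos hℓ hℓw hpos).le)

/-- **`|q|_w = 1 ⟺ q ≠ 0 ∧ ord_ℓ q = 0`** for `q ∈ ℚ` and a finite place `w` above `ℓ`. [folklore] [cite: NeukirchANT1999, Ch. II §8 (w ∣ v, e(w|v): ord_w = e·ord_v on the ground field)] -/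
theorem valuation_ratCast_eq_one_iff_padicValRat_eq_zero (hℓ : ℓ.Prime) (hℓw : (ℓ : 𝓞 L) ∈ w.asIdeal) (q : ℚ) :
    w.valuation L (q : L) = 1 ↔ q ≠ 0 ∧ padicValRat ℓ q = 0 := by
  refine ⟨fun h => ?_, fun h => valuation_ratCast_eq_one_of_padicValRat_eq_zero hℓ hℓw h.1 h.2⟩
  have hq0 : q ≠ 0 := by rintro rfl; simp at h
  refine ⟨hq0, ?_⟩
  rcases lt_trichotomy (padicValRat ℓ q) 0 with hneg | h0 | hpos
  · exact absurd h (ne_of_gt (one_lt_valuation_ratCast_of_padicValRat_neg hℓ hℓw hneg))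
  · exact h0
  · exact absurd h (ne_of_lt (valuation_ratCast_lt_one_of_padicValRat_pos hℓ hℓw hpos))

end Places

/-! ## §2 `E₀` of a rational point is read at the rational prime -/

section RationalPoints

variable (W : WeierstrassCurve ℚ) (L : Type) [Field L] [NumberField L] (w : HeightOneSpectrum (𝓞 L)) {ℓ : ℕ}

/-- **Coordinate form.**  For `x, y ∈ ℚ`, a number field `L` and a finite place `w` of `L` above `ℓ`: the `E₀`-condition of `(x, y)` at `w`
(`|x|_w > 1`, or `Φ_x`/`Φ_y` a `w`-adic unit — `HasNonsingularReductionAtK`) is the one at `ℓ` (`ord_ℓ x < 0`, or `Φ_x ≠ 0 ∧ ord_ℓ Φ_x = 0`, or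
the same for `Φ_y` — `HasNonsingularReductionAt`).  No ramification hypothesis. [cite: SilvermanAEC2009, VII §2 (definition of E₀)]
[cite: NeukirchANT1999, Ch. II §8 (w ∣ v, e(w|v))] -/
theorem hasNonsingularReductionAtK_algebraMap_iff (hℓ : ℓ.Prime) (hℓw : (ℓ : 𝓞 L) ∈ w.asIdeal) (x y : ℚ) :
    W.HasNonsingularReductionAtK L w (algebraMap ℚ L x) (algebraMap ℚ L y) ↔ W.HasNonsingularReductionAt ℓ x y := by
  unfold WeierstrassCurve.HasNonsingularReductionAtK WeierstrassCurve.HasNonsingularReductionAt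
  rw [W.baseChange_polynomialX_evalEval L, W.baseChange_polynomialY_evalEval L]
  simp only [eq_ratCast]
  rw [one_lt_valuation_ratCast_iff_padicValRat_neg hℓ hℓw, valuation_ratCast_eq_one_iff_padicValRat_eq_zero hℓ hℓw,
    valuation_ratCast_eq_one_iff_padicValRat_eq_zero hℓ hℓw]

/-- **`E₀` OF A RATIONAL POINT IS READ AT THE RATIONAL PRIME (affine points).**  `W/ℚ` with integer coefficients, `L` a number field, `w` a
finite place of `L` above the rational prime `ℓ`, `(x, y) ∈ W(ℚ)`: its image in `W(L)` has nonsingular reduction at `w` ON THE MODEL `W`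
(`placeIntModel`, the currency of `Gross1991_heegnerPoint_sub_ratTorsion_mem_E0` and of the component road) iff `W.HasNonsingularReductionAt ℓ x y`.
[cite: SilvermanAEC2009, VII §2 Prop. 2.1] [cite: NeukirchANT1999, Ch. II §8 (w ∣ v, e(w|v))] -/
theorem hasNonsingularReduction_placeIntModel_pointToBaseChange_some_iff [W.IsIntegral ℤ] (hℓ : ℓ.Prime)
    (hℓw : (ℓ : 𝓞 L) ∈ w.asIdeal) {x y : ℚ} (h : W.toAffine.Nonsingular x y) :
    WeierstrassCurve.HasNonsingularReduction (K := L) (placeIntModel W L w) (W.pointToBaseChange L (.some x y h)) ↔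
      W.HasNonsingularReductionAt ℓ x y := by
  have h' : (W.baseChange L).toAffine.Nonsingular (algebraMap ℚ L x) (algebraMap ℚ L y) :=
    (Affine.map_nonsingular (W := W.toAffine) (algebraMap ℚ L).injective x y).2 h
  have hpt : W.pointToBaseChange L (.some x y h) = .some _ _ h' := rfl
  rw [hpt]
  exact (hasNonsingularReduction_placeIntModel_iff (W := W) (K := L) w h').trans
    (hasNonsingularReductionAtK_algebraMap_iff W L w hℓ hℓw x y)

/-- **`E₀` OF A RATIONAL POINT IS READ AT THE RATIONAL PRIME (all points).**  Same, for an arbitrary `P ∈ W(ℚ)` (`O ∈ E₀` always): `P ∈ E₀(L)_w`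
iff, whenever `P = (x, y)` is affine, `W.HasNonsingularReductionAt ℓ x y`. [cite: SilvermanAEC2009, VII §2 Prop. 2.1] -/
theorem hasNonsingularReduction_placeIntModel_pointToBaseChange_iff_forall [W.IsIntegral ℤ] (hℓ : ℓ.Prime)
    (hℓw : (ℓ : 𝓞 L) ∈ w.asIdeal) (P : W.toAffine.Point) :
    WeierstrassCurve.HasNonsingularReduction (K := L) (placeIntModel W L w) (W.pointToBaseChange L P) ↔
      ∀ (x y : ℚ) (h : W.toAffine.Nonsingular x y), P = .some x y h → W.HasNonsingularReductionAt ℓ x y := by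
  rcases P with _ | ⟨x, y, h⟩
  · refine iff_of_true ?_ ?_
    · exact WeierstrassCurve.hasNonsingularReduction_zero (K := L) (W := placeIntModel W L w)
    · intro x y h hP
      exact absurd hP (by rintro ⟨⟩)
  · rw [hasNonsingularReduction_placeIntModel_pointToBaseChange_some_iff W L w hℓ hℓw h]
    refine ⟨fun hns x' y' h' he => ?_, fun H => H x y h rfl⟩
    obtain ⟨rfl, rfl⟩ : x = x' ∧ y = y' := by simpa using he
    exact hns

end RationalPoints

/-! ## §3 Multiples of a rational point; the certificate form of the component-order hypothesis -/

section Multiples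

variable (W : WeierstrassCurve ℚ) (L : Type) [Field L] [NumberField L]

/-- Multiples commute with `E(ℚ) → E(L)` (Mathlib's `Affine.Point.map` is a homomorphism; `pointToBaseChange_eq_map`), for an ARBITRARY
`DecidableEq` instance on `L` (the group law on `W(L)` does not depend on it: `DecidableEq L` is a subsingleton — same device as
`…ComponentRoad.hasNonsingularReduction_placeIntModel_add`). [folklore] -/
theorem zsmul_pointToBaseChange [DecidableEq L] (k : ℤ) (P : W.toAffine.Point) :
    k • W.pointToBaseChange L P = W.pointToBaseChange L (k • P) := by
  obtain rfl : ‹DecidableEq L› = fun a b ↦ Classical.propDecidable (a = b) := Subsingleton.elim _ _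
  rw [W.pointToBaseChange_eq_map L, W.pointToBaseChange_eq_map L]
  exact (map_zsmul (Affine.Point.map (W' := W) (F := ℚ) (Algebra.ofId ℚ L)) k P).symm

variable {W L} in
/-- The rational points with nonsingular reduction at `ℓ` (read through any place `w ∋ ℓ` of any `L`) are closed under `ℤ`-linear combinations:
if `a • g` and `b • g` are in `E₀(ℚ)_ℓ` then so is `(i a + j b) • g`.  (`E₀(L)_w` is a subgroup, AEC VII.2.1, tree `nonsingularReductionSubgroupAtPlace`.)
[cite: SilvermanAEC2009, VII §2 Prop. 2.1] -/
theorem hasNonsingularReduction_pointToBaseChange_linear_comb [W.IsIntegral ℤ] (w : HeightOneSpectrum (𝓞 L)) (g : W.toAffine.Point)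
    {a b : ℤ} (ha : WeierstrassCurve.HasNonsingularReduction (K := L) (placeIntModel W L w) (W.pointToBaseChange L (a • g)))
    (hb : WeierstrassCurve.HasNonsingularReduction (K := L) (placeIntModel W L w) (W.pointToBaseChange L (b • g))) (i j : ℤ) :
    WeierstrassCurve.HasNonsingularReduction (K := L) (placeIntModel W L w) (W.pointToBaseChange L ((i * a + j * b) • g)) := by
  have ha' : W.pointToBaseChange L (a • g) ∈ nonsingularReductionSubgroupAtPlace W L w := ha
  have hb' : W.pointToBaseChange L (b • g) ∈ nonsingularReductionSubgroupAtPlace W L w := hb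
  have e : (i * a + j * b) • g = i • (a • g) + j • (b • g) := by rw [add_zsmul, mul_zsmul, mul_zsmul]
  have hmem : W.pointToBaseChange L ((i * a + j * b) • g) ∈ nonsingularReductionSubgroupAtPlace W L w := by
    rw [e, W.pointToBaseChange_add L, ← zsmul_pointToBaseChange W L i (a • g), ← zsmul_pointToBaseChange W L j (b • g)]
    exact AddSubgroup.add_mem _ (AddSubgroup.zsmul_mem _ ha' i) (AddSubgroup.zsmul_mem _ hb' j)
  exact hmem

variable {W} in
/-- **CERTIFICATE FORM OF THE COMPONENT-ORDER HYPOTHESIS.**  `W/ℚ` with integer coefficients, `g ∈ W(ℚ)`, `ℓ` prime, `m ≥ 1`.  If `m • g` has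
nonsingular reduction at `ℓ` and `k • g` does NOT for `0 < k < m` (a FINITE check on rational coordinates: `padicValRat` of `x`, `Φ_x`, `Φ_y`), then
for every `k ∈ ℤ`: `k • g ∈ E₀(ℚ)_ℓ ⟹ m ∣ k` — i.e. the component of `g` in `Φ_ℓ(ℚ_ℓ) = W(ℚ_ℓ)/W₀(ℚ_ℓ)` has order exactly `m`
(`E₀` is a subgroup; Euclidean division).  «`P ∈ E₀(ℚ)_ℓ`» is spelled «`P = (x, y) ⟹ W.HasNonsingularReductionAt ℓ x y`» (`O ∈ E₀`).
[cite: SilvermanAEC2009, VII §2 Prop. 2.1] -/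
theorem natCast_dvd_of_componentOrder [W.IsIntegral ℤ] {ℓ : ℕ} (hℓ : ℓ.Prime) (g : W.toAffine.Point) {m : ℕ} (hm : 0 < m)
    (hmE0 : ∀ (x y : ℚ) (h : W.toAffine.Nonsingular x y), (m : ℤ) • g = .some x y h → W.HasNonsingularReductionAt ℓ x y)
    (hmin : ∀ k : ℕ, 0 < k → k < m →
      ¬ ∀ (x y : ℚ) (h : W.toAffine.Nonsingular x y), (k : ℤ) • g = .some x y h → W.HasNonsingularReductionAt ℓ x y)
    (k : ℤ) (hk : ∀ (x y : ℚ) (h : W.toAffine.Nonsingular x y), k • g = .some x y h → W.HasNonsingularReductionAt ℓ x y) :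
    (m : ℤ) ∣ k := by
  -- read everything at a place `w ∋ ℓ` of `L := ℚ` itself, where `E₀` is a subgroup
  obtain ⟨w, hℓw⟩ := exists_heightOneSpectrum_natCast_mem ℚ hℓ
  have key : ∀ c : ℤ, WeierstrassCurve.HasNonsingularReduction (K := ℚ) (placeIntModel W ℚ w) (W.pointToBaseChange ℚ (c • g)) ↔
      ∀ (x y : ℚ) (h : W.toAffine.Nonsingular x y), c • g = .some x y h → W.HasNonsingularReductionAt ℓ x y :=
    fun c => hasNonsingularReduction_placeIntModel_pointToBaseChange_iff_forall W ℚ w hℓ hℓw (c • g)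
  have hmL := (key m).mpr hmE0
  have hkL := (key k).mpr hk
  -- Euclidean division `k = q m + r`, `0 ≤ r < m`; `r • g = (1·k + (−q)·m) • g ∈ E₀`
  have hm0 : (m : ℤ) ≠ 0 := by exact_mod_cast hm.ne'
  set r := k % (m : ℤ) with hr
  have hr0 : 0 ≤ r := Int.emod_nonneg k hm0
  have hrm : r < (m : ℤ) := Int.emod_lt_of_pos k (by exact_mod_cast hm)
  have hrk : r = 1 * k + (-(k / (m : ℤ))) * (m : ℤ) := by
    rw [hr, Int.emod_def]; ring
  have hrL : WeierstrassCurve.HasNonsingularReduction (K := ℚ) (placeIntModel W ℚ w) (W.pointToBaseChange ℚ (r • g)) := by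
    rw [hrk]
    exact hasNonsingularReduction_pointToBaseChange_linear_comb (L := ℚ) w g hkL hmL 1 (-(k / (m : ℤ)))
  -- `r = 0`, else `hmin` at `r.toNat`
  by_contra hndvd
  have hr_ne : r ≠ 0 := fun h0 => hndvd (Int.dvd_of_emod_eq_zero (by rw [← hr, h0]))
  have hrpos : 0 < r := lt_of_le_of_ne hr0 (Ne.symm hr_ne)
  obtain ⟨n, hn⟩ : ∃ n : ℕ, r = (n : ℤ) := ⟨r.toNat, (Int.toNat_of_nonneg hr0).symm⟩
  rw [hn] at hrpos hrm hrL
  exact hmin n (by exact_mod_cast hrpos) (by exact_mod_cast hrm) ((key n).mp hrL)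

end Multiples

/-! ## §4 The component road read at the rational prime `q₀ ∣ N` -/

section Road

/-- **THE COMPONENT ROAD, READ AT THE RATIONAL PRIME** (conditional on GZ III (3.1), displayed).  `W/ℚ` globally minimal with `W(ℚ)[2] = 0` and
`w(W) = −1`; `K` imaginary quadratic with odd `d_K ≠ −3`, Heegner for `N_W`; a conductor-`1` Kolyvagin–Heegner datum `d₁` (`P(1) = y_K`); `g` ANY
point of `W(ℚ)` generating `W(ℚ)` modulo torsion; `q₀ ∣ N_W` a prime; and the COMPONENT-ORDER HYPOTHESIS AT `q₀` OVER `ℚ`: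
«`k • g ∈ E₀(ℚ)_{q₀} ⟹ 2^s ∣ k`» (the component of `g` in `Φ_{q₀}(ℚ_{q₀})` has `2`-order `≥ 2^s`; `E₀` read on the minimal equation `W` in the
`padicValRat` currency `HasNonsingularReductionAt`).  THEN **`2^s ∣ P(1)` in `W(K[1])`**.  Proof: any place `w₀` of `K[1]` above `q₀` lies above `N`,
and by §2 the hypothesis at `q₀` IS gk2-p2's hypothesis at `w₀` (`…ComponentRoadFrame.exists_two_pow_smul_eq_derivedPoint_one_of_generator_componentOrder`).
On the sub-slice where the component of `g` generates the `2`-part of `C(W)` this is DIV′'s «`2^{ord₂ C(W)} ∣ P(1)`» from PRINT (GZ III (3.1)) — MAX-type,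
one prime at a time; it does not prove DIV′.  [cite: GrossLMS1991, §6 proof of Prop. 6.2 (1) (p. 245); §4 (4.1)] [cite: GrossZagier1986Heegner, III (3.1)]
[cite: SilvermanAEC2009, VII §2 Prop. 2.1] -/
theorem exists_two_pow_smul_eq_derivedPoint_one_of_generator_componentOrder_rat
    (hGZ31 : Gross1991_heegnerPoint_sub_ratTorsion_mem_E0_imageFree)
    (W : WeierstrassCurve ℚ) [W.IsElliptic] [W.IsGloballyMinimal] [NeZero (W.conductorNorm ℤ)]
    (hT2 : ∀ P : W.toAffine.Point, 2 • P = 0 → P = 0) (hw : W.rootNumber = -1)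
    {K : Type} [Field K] [NumberField K] (hK : IsImaginaryQuadratic K) (hodd : Odd (NumberField.discr K))
    (h3 : NumberField.discr K ≠ -3) (hH : SatisfiesHeegnerHypothesis (W.conductorNorm ℤ) K)
    (Dt : ModularParametrizationData W (W.conductorNorm ℤ)) (β : ℤ) (ι : K →+* ℂ) [NumberField (ringClassField K ι 1)]
    (d₁ : KolyvaginHeegnerData Dt β ι 1)
    (g : W.toAffine.Point)
    (hg : ∀ x : W.toAffine.Point, ∃ k : ℤ, IsOfFinAddOrder (QuadraticDescent.incl K W x - k • QuadraticDescent.incl K W g))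
    {q₀ : ℕ} (hq₀ : q₀.Prime) (hq₀N : q₀ ∣ (W.conductorNorm ℤ : ℕ)) (s : ℕ)
    (hs : ∀ k : ℤ, (∀ (x y : ℚ) (h : W.toAffine.Nonsingular x y), k • g = .some x y h → W.HasNonsingularReductionAt q₀ x y) →
      ((2 ^ s : ℕ) : ℤ) ∣ k) :
    ∃ Q : (W.baseChange (ringClassField K ι 1)).toAffine.Point, ((2 ^ s : ℕ) : ℤ) • Q = d₁.derivedPoint := by
  obtain ⟨w₀, hw₀q⟩ := exists_heightOneSpectrum_natCast_mem (ringClassField K ι 1) hq₀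
  have hw₀ : (((W.conductorNorm ℤ : ℕ) : ℕ) : 𝓞 (ringClassField K ι 1)) ∈ w₀.asIdeal := by
    obtain ⟨m, hm⟩ := hq₀N
    rw [hm, Nat.cast_mul]
    exact w₀.asIdeal.mul_mem_right _ hw₀q
  refine ComponentRoad.exists_two_pow_smul_eq_derivedPoint_one_of_generator_componentOrder hGZ31 W hT2 hw hK hodd h3 hH Dt β ι d₁ g hg
    w₀ hw₀ s fun k hk => hs k ?_
  have hk' : WeierstrassCurve.HasNonsingularReduction (K := ringClassField K ι 1) (placeIntModel W (ringClassField K ι 1) w₀)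
      (W.pointToBaseChange (ringClassField K ι 1) (k • g)) := by
    rw [← zsmul_pointToBaseChange]; exact hk
  exact (hasNonsingularReduction_placeIntModel_pointToBaseChange_iff_forall W (ringClassField K ι 1) w₀ hq₀ hw₀q (k • g)).mp hk'

/-- The same with `w(W) = −1` replaced by `r_an(W) = 1` (parity through the datum, `TwinSwapBit.rootNumber_eq_neg_one_of_analyticRank_eq_one`).
[cite: GrossLMS1991, §6 proof of Prop. 6.2 (1)] [cite: GrossZagier1986Heegner, III (3.1)] -/
theorem exists_two_pow_smul_eq_derivedPoint_one_of_generator_componentOrder_rat_of_analyticRank_eq_one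
    (hGZ31 : Gross1991_heegnerPoint_sub_ratTorsion_mem_E0_imageFree)
    (W : WeierstrassCurve ℚ) [W.IsElliptic] [W.IsGloballyMinimal] [NeZero (W.conductorNorm ℤ)]
    (hT2 : ∀ P : W.toAffine.Point, 2 • P = 0 → P = 0) (hr : W.analyticRank = 1)
    {K : Type} [Field K] [NumberField K] (hK : IsImaginaryQuadratic K) (hodd : Odd (NumberField.discr K))
    (h3 : NumberField.discr K ≠ -3) (hH : SatisfiesHeegnerHypothesis (W.conductorNorm ℤ) K)
    (Dt : ModularParametrizationData W (W.conductorNorm ℤ)) (β : ℤ) (ι : K →+* ℂ) [NumberField (ringClassField K ι 1)]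
    (d₁ : KolyvaginHeegnerData Dt β ι 1)
    (g : W.toAffine.Point)
    (hg : ∀ x : W.toAffine.Point, ∃ k : ℤ, IsOfFinAddOrder (QuadraticDescent.incl K W x - k • QuadraticDescent.incl K W g))
    {q₀ : ℕ} (hq₀ : q₀.Prime) (hq₀N : q₀ ∣ (W.conductorNorm ℤ : ℕ)) (s : ℕ)
    (hs : ∀ k : ℤ, (∀ (x y : ℚ) (h : W.toAffine.Nonsingular x y), k • g = .some x y h → W.HasNonsingularReductionAt q₀ x y) →
      ((2 ^ s : ℕ) : ℤ) ∣ k) :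
    ∃ Q : (W.baseChange (ringClassField K ι 1)).toAffine.Point, ((2 ^ s : ℕ) : ℤ) • Q = d₁.derivedPoint :=
  exists_two_pow_smul_eq_derivedPoint_one_of_generator_componentOrder_rat hGZ31 W hT2 (rootNumber_eq_neg_one_of_analyticRank_eq_one W hr Dt)
    hK hodd h3 hH Dt β ι d₁ g hg hq₀ hq₀N s hs

/-- **THE COMPONENT ROAD, CERTIFICATE FORM** (conditional on GZ III (3.1), displayed).  As `…_rat`, with the component-order hypothesis replaced by a
FINITE CERTIFICATE: an `m` with `2^s ∣ m`, `m • g ∈ E₀(ℚ)_{q₀}` and `k • g ∉ E₀(ℚ)_{q₀}` for `0 < k < m` (the component of `g` in `Φ_{q₀}(ℚ_{q₀})` has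
order exactly `m`).  THEN `2^s ∣ P(1)` in `W(K[1])`.  This is the -data-readable instrument: one generator, one bad prime, `padicValRat` of three
rationals for each of `m` multiples. [cite: GrossLMS1991, §6 proof of Prop. 6.2 (1)] [cite: GrossZagier1986Heegner, III (3.1)] [cite: SilvermanAEC2009, VII §2 Prop. 2.1] -/
theorem exists_two_pow_smul_eq_derivedPoint_one_of_componentOrder_certificate
    (hGZ31 : Gross1991_heegnerPoint_sub_ratTorsion_mem_E0_imageFree)
    (W : WeierstrassCurve ℚ) [W.IsElliptic] [W.IsGloballyMinimal] [NeZero (W.conductorNorm ℤ)]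
    (hT2 : ∀ P : W.toAffine.Point, 2 • P = 0 → P = 0) (hw : W.rootNumber = -1)
    {K : Type} [Field K] [NumberField K] (hK : IsImaginaryQuadratic K) (hodd : Odd (NumberField.discr K))
    (h3 : NumberField.discr K ≠ -3) (hH : SatisfiesHeegnerHypothesis (W.conductorNorm ℤ) K)
    (Dt : ModularParametrizationData W (W.conductorNorm ℤ)) (β : ℤ) (ι : K →+* ℂ) [NumberField (ringClassField K ι 1)]
    (d₁ : KolyvaginHeegnerData Dt β ι 1)
    (g : W.toAffine.Point)
    (hg : ∀ x : W.toAffine.Point, ∃ k : ℤ, IsOfFinAddOrder (QuadraticDescent.incl K W x - k • QuadraticDescent.incl K W g))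
    {q₀ : ℕ} (hq₀ : q₀.Prime) (hq₀N : q₀ ∣ (W.conductorNorm ℤ : ℕ)) (s : ℕ) {m : ℕ} (hm : 0 < m) (hsm : 2 ^ s ∣ m)
    (hmE0 : ∀ (x y : ℚ) (h : W.toAffine.Nonsingular x y), (m : ℤ) • g = .some x y h → W.HasNonsingularReductionAt q₀ x y)
    (hmin : ∀ k : ℕ, 0 < k → k < m →
      ¬ ∀ (x y : ℚ) (h : W.toAffine.Nonsingular x y), (k : ℤ) • g = .some x y h → W.HasNonsingularReductionAt q₀ x y) :
    ∃ Q : (W.baseChange (ringClassField K ι 1)).toAffine.Point, ((2 ^ s : ℕ) : ℤ) • Q = d₁.derivedPoint :=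
  exists_two_pow_smul_eq_derivedPoint_one_of_generator_componentOrder_rat hGZ31 W hT2 hw hK hodd h3 hH Dt β ι d₁ g hg hq₀ hq₀N s
    fun k hk => (Int.natCast_dvd_natCast.mpr hsm).trans (natCast_dvd_of_componentOrder hq₀ g hm hmE0 hmin k hk)

end Road

end Summit.BirchSwinnertonDyer.BirchSwinnertonDyer.Theorems.GenusExact.TwinSwap.ComponentRoad.Rational

end
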